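import Summits.Parity.GeneralizedHardyLittlewood.Theorems.GreenTaoLevelTwoGITwoCyclicInverseBohrRegularPrelims
import Mathlib.Analysis.Complex.Basic

/-!
# Route `GreenTaoLevelTwo`, crux `GITwo` (stmt-Parity-21275), line `birth`, stub `stub_cyclicInverse`:
# C13 assembly, step 5 preliminaries: `B₅ + B₄ ⊆ B(S',ρ₄+ρ₅)` and pigeonholing the translate
# (GT08a §9 Step 4, "`𝔼(1_{B₄})/𝔼(1_{B₄+B₅}) ≥ 1/2`")

Eighty-third helper file toward the XL stub `stub_cyclicInverse` (B. Green, T. Tao, *An inverse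
theorem for the Gowers `U³(G)` norm*, arXiv:math/0503014, Thm. 68 = PEMS 51 (2008) Thm. 12.8).
Block C13 (§9 Step 4: "Since `B₄` is regular and `ε₅` is so small, we certainly have
`𝔼(1_{B₄})/(𝔼 1_{B₄+B₅}) ≥ 1/2`, and so [Lemma 23] allows us to conclude …"; and the final choice of
the translate `y`).  Def-free:

* `bohr_add_bohr_subset` — `B(S,ρ₅) + B(S,ρ₄) ⊆ B(S,ρ₄+ρ₅)` (pointwise sum of finsets);
* `card_bohr_add_bohr_le` — hence `#(B(S,ρ₅) + B(S,ρ₄)) ≤ (1 + 100 d (ρ₅/ρ₄)) #B(S,ρ₄)` for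
  `B(S,ρ₄)` regular and `ρ₅ ≤ ρ₄/(100d)`;
* `exists_translate_ge_of_sum_ge` — `C·N ≤ Σ_{y : ℤ/Nℤ} g(y)` ⇒ `∃ y, C ≤ g(y)`.

References: [GreenTao2008U3Inverse] arXiv:math/0503014, §9 Step 4.
-/

noncomputable section

namespace Summit.Parity.GeneralizedHardyLittlewood.GreenTaoLevelTwoGITwoCyclicInverse

open Finset
open scoped Pointwise

variable {N : ℕ} [NeZero N]

/-- `B(S,ρ₅) + B(S,ρ₄) ⊆ B(S,ρ₄+ρ₅)`. [folklore] -/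
theorem bohr_add_bohr_subset [DecidableEq (ZMod N)] (S : Finset (ZMod N)) (ρ₄ ρ₅ : ℝ) :
    ({x : ZMod N | ∀ ξ ∈ S, ‖ZMod.toAddCircle (x * ξ)‖ < ρ₅} : Finset (ZMod N)) +
        ({x : ZMod N | ∀ ξ ∈ S, ‖ZMod.toAddCircle (x * ξ)‖ < ρ₄} : Finset (ZMod N)) ⊆
      ({x : ZMod N | ∀ ξ ∈ S, ‖ZMod.toAddCircle (x * ξ)‖ < ρ₄ + ρ₅} : Finset (ZMod N)) := by
  intro z hz
  rw [Finset.mem_add] at hz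
  obtain ⟨w, hw, h, hh, rfl⟩ := hz
  rw [mem_filter] at hw hh ⊢
  refine ⟨mem_univ _, fun ξ hξ => ?_⟩
  rw [add_mul, map_add]
  calc ‖ZMod.toAddCircle (w * ξ) + ZMod.toAddCircle (h * ξ)‖
      ≤ ‖ZMod.toAddCircle (w * ξ)‖ + ‖ZMod.toAddCircle (h * ξ)‖ := norm_add_le _ _
    _ < ρ₅ + ρ₄ := add_lt_add (hw.2 ξ hξ) (hh.2 ξ hξ)
    _ = ρ₄ + ρ₅ := add_comm _ _

/-- **`#(B₅ + B₄) ≤ (1 + 100 d ρ₅/ρ₄) #B₄`** for `B₄ = B(S,ρ₄)` regular, `B₅ = B(S,ρ₅)`,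
`0 < ρ₅ ≤ ρ₄/(100d)`. [cite: GreenTao2008U3Inverse, §9 Step 4] -/
theorem card_bohr_add_bohr_le [DecidableEq (ZMod N)] (S : Finset (ZMod N)) {ρ₄ ρ₅ : ℝ}
    (hρ₄ : 0 < ρ₄) (hρ₅ : 0 < ρ₅) (hsmall : ρ₅ / ρ₄ ≤ 1 / (100 * (#S : ℝ)))
    (hreg : ∀ r : ℝ, |r| ≤ 1 / (100 * (#S : ℝ)) →
      (1 - 100 * (#S : ℝ) * |r|) * #{x : ZMod N | ∀ ξ ∈ S, ‖ZMod.toAddCircle (x * ξ)‖ < ρ₄} ≤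
          #{x : ZMod N | ∀ ξ ∈ S, ‖ZMod.toAddCircle (x * ξ)‖ < (1 + r) * ρ₄} ∧
        (#{x : ZMod N | ∀ ξ ∈ S, ‖ZMod.toAddCircle (x * ξ)‖ < (1 + r) * ρ₄} : ℝ) ≤
          (1 + 100 * (#S : ℝ) * |r|) * #{x : ZMod N | ∀ ξ ∈ S, ‖ZMod.toAddCircle (x * ξ)‖ < ρ₄}) :
    (#(({x : ZMod N | ∀ ξ ∈ S, ‖ZMod.toAddCircle (x * ξ)‖ < ρ₅} : Finset (ZMod N)) +
        ({x : ZMod N | ∀ ξ ∈ S, ‖ZMod.toAddCircle (x * ξ)‖ < ρ₄} : Finset (ZMod N))) : ℝ) ≤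
      (1 + 100 * (#S : ℝ) * (ρ₅ / ρ₄)) * #{x : ZMod N | ∀ ξ ∈ S, ‖ZMod.toAddCircle (x * ξ)‖ < ρ₄} := by
  have hr : 0 < ρ₅ / ρ₄ := div_pos hρ₅ hρ₄
  have h1 := (hreg (ρ₅ / ρ₄) (by rw [abs_of_pos hr]; exact hsmall)).2
  rw [abs_of_pos hr] at h1
  have e : (1 + ρ₅ / ρ₄) * ρ₄ = ρ₄ + ρ₅ := by field_simp
  rw [e] at h1
  have h2 : (#(({x : ZMod N | ∀ ξ ∈ S, ‖ZMod.toAddCircle (x * ξ)‖ < ρ₅} : Finset (ZMod N)) +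
      ({x : ZMod N | ∀ ξ ∈ S, ‖ZMod.toAddCircle (x * ξ)‖ < ρ₄} : Finset (ZMod N))) : ℝ) ≤
      #{x : ZMod N | ∀ ξ ∈ S, ‖ZMod.toAddCircle (x * ξ)‖ < ρ₄ + ρ₅} := by
    exact_mod_cast card_le_card (bohr_add_bohr_subset S ρ₄ ρ₅)
  exact h2.trans h1

omit [NeZero N] in
/-- **Pigeonholing the translate**: `C · N ≤ Σ_{y ∈ ℤ/Nℤ} g(y)` gives some `y` with `C ≤ g(y)`
(`N ≥ 1`). [folklore] -/
theorem exists_translate_ge_of_sum_ge [NeZero N] (g : ZMod N → ℝ) {C : ℝ}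
    (h : C * N ≤ ∑ y : ZMod N, g y) : ∃ y : ZMod N, C ≤ g y := by
  by_contra hcon
  push Not at hcon
  have hlt : ∑ y : ZMod N, g y < ∑ _y : ZMod N, C :=
    Finset.sum_lt_sum_of_nonempty Finset.univ_nonempty fun y _ => hcon y
  rw [Finset.sum_const, Finset.card_univ, ZMod.card, nsmul_eq_mul] at hlt
  linarith

end Summit.Parity.GeneralizedHardyLittlewood.GreenTaoLevelTwoGITwoCyclicInverse
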